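import Summits.AtomisticToContinuum.HydrodynamicLimit.Theorems.EnskogAdjointDualityAdjointEnskogTestFamilyRTransferReductionSwap
import Summits.AtomisticToContinuum.HydrodynamicLimit.Theorems.EnskogAdjointDualityAdjointEnskogTestFamilyRPairGaussianEqual
import Summits.AtomisticToContinuum.HydrodynamicLimit.Theorems.EnskogAdjointDualityDualityReductionProfiles
import HarnessLib

/-!
# K2R transfer reduction II: `B_ψ = λ_N T` (the registered statement `stub_transferReduction`)

Route `EnskogAdjointDuality` of `AtomisticToContinuum/HydrodynamicLimit`, crux `AdjointEnskogTestFamilyR`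
(stmt-AtomisticToContinuum-11592, "K2R"), line `birth`, stub `stub_transferReduction` (G3a): the collisional
transfer of the hydrodynamic part `ψ = α + β·v + γ|v|²/2` of the test family,
`B_ψ(N, s) = ∫_{𝕋³} ∫ f_s(x, v) (L^N_s ψ)(x, v) dv dx`, `f = ρ M_{1,θ,u}` the Euler local Maxwellian, equals
`λ_N T(N, s)` with the position × direction form
`T = ∫_{S²} ∫_{𝕋³} −Y ρ(x) ρ(y) [(β(x) − β(y))·ω J₁ + (γ(x) − γ(y)) J₂] dx dσ(ω)`, `y = x + ε_N ω`,
`J₁ = ∫∫ q₊ q M_x(v) M_y(w)`, `J₂ = ∫∫ q₊ q ((v+w)·ω/2) M_x(v) M_y(w)`, `q = (v − w)·ω`: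

* `k2r_tr_affine_increment` — the collision increment of an affine-in-`(1, v, |v|²)` function:
  `ψ_x(v′) + ψ_y(w′) − ψ_x(v) − ψ_y(w) = −q [(β_x − β_y)·ω + (γ_x − γ_y)(v + w)·ω/2]`
  (momentum and energy conservation of the elastic collision; the `α`'s cancel);
* `k2r_tr_abs_affine_le` — quadratic velocity growth of `ψ`;
* `k2r_tr_slice` — for a fixed position pair and impact direction, the two velocity integrals of the
  transfer integrand are `−Y ρ ρ′ [(β − β′)·ω J₁ + (γ − γ′) J₂]` (linearity; everything is absolutely
  convergent against the two Maxwellians);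
* `k2r_tr_reduction` — the identity for a general continuous background and coefficient field
  (`k2r_tr_pairing_swap` of the companion file: the impact direction is integrated last; then
  `k2r_tr_slice` pointwise in `(ω, x)`);
* `stub_transferReduction` — EXACTLY the registered Prop `TransferReduction` of the skeleton
  `Cruxes/AdjointEnskogTestFamilyR/Lines/birth.lean` (its `let`-chain verbatim), from the window facts of the
  hs-Euler solution (`eulerProfiles_window`, `contactValue_window`).

References: S. Chapman, T. G. Cowling, *The Mathematical Theory of Non-uniform Gases* (1970), §16
(collisional transfer) [ChapmanCowling1970]; C. Cercignani, R. Illner, M. Pulvirenti, *The Mathematical Theory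
of Dilute Gases* (1994), §3.1 (collision kinematics) [CIP1994].
-/

noncomputable section

open MeasureTheory ProbabilityTheory Metric Set Filter Topology Function
open scoped InnerProductSpace ENNReal

namespace Summit.AtomisticToContinuum.HydrodynamicLimit.Theorems.EnskogAdjointDuality

open Literature.Analysis.FluidPDE Literature.MathematicalPhysics.KineticTheory

/-! ## The collision increment of an affine test function -/

/-- **Collision increment of `ψ = α + β·v + γ|v|²/2`.** For a unit vector `ω`, `q = (v − w)·ω`,
`v′ = v − qω`, `w′ = w + qω` and two coefficient triples `(α, β, γ)` at `x` and `(α′, β′, γ′)` at `y`: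
`ψ_x(v′) + ψ_y(w′) − ψ_x(v) − ψ_y(w) = −q [(β − β′)·ω + (γ − γ′) (v + w)·ω / 2]`
(`β·(v′ − v) = −q β·ω`, `|v′|² − |v|² = −q (v + w)·ω`, and symmetrically for `w`). [cite: CIP1994, §3.1] -/
theorem k2r_tr_affine_increment (ω : sphere (0 : V3) 1) (cx cy : ℝ × V3 × ℝ) (v w : V3) :
    (cx.1 + ⟪cx.2.1, v - ⟪v - w, (ω : V3)⟫_ℝ • (ω : V3)⟫_ℝ +
        cx.2.2 * ‖v - ⟪v - w, (ω : V3)⟫_ℝ • (ω : V3)‖ ^ 2 / 2) +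
      (cy.1 + ⟪cy.2.1, w + ⟪v - w, (ω : V3)⟫_ℝ • (ω : V3)⟫_ℝ +
        cy.2.2 * ‖w + ⟪v - w, (ω : V3)⟫_ℝ • (ω : V3)‖ ^ 2 / 2) -
      (cx.1 + ⟪cx.2.1, v⟫_ℝ + cx.2.2 * ‖v‖ ^ 2 / 2) -
      (cy.1 + ⟪cy.2.1, w⟫_ℝ + cy.2.2 * ‖w‖ ^ 2 / 2) =
    -(⟪v - w, (ω : V3)⟫_ℝ * (⟪cx.2.1 - cy.2.1, (ω : V3)⟫_ℝ +
      (cx.2.2 - cy.2.2) * (⟪v + w, (ω : V3)⟫_ℝ / 2))) := by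
  have hω : ‖(ω : V3)‖ = 1 := norm_eq_of_mem_sphere ω
  have h1 : ⟪cx.2.1, v - ⟪v - w, (ω : V3)⟫_ℝ • (ω : V3)⟫_ℝ =
      ⟪cx.2.1, v⟫_ℝ - ⟪v - w, (ω : V3)⟫_ℝ * ⟪cx.2.1, (ω : V3)⟫_ℝ := by
    rw [inner_sub_right, inner_smul_right]
  have h2 : ⟪cy.2.1, w + ⟪v - w, (ω : V3)⟫_ℝ • (ω : V3)⟫_ℝ =
      ⟪cy.2.1, w⟫_ℝ + ⟪v - w, (ω : V3)⟫_ℝ * ⟪cy.2.1, (ω : V3)⟫_ℝ := by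
    rw [inner_add_right, inner_smul_right]
  have h3 : ‖v - ⟪v - w, (ω : V3)⟫_ℝ • (ω : V3)‖ ^ 2 =
      ‖v‖ ^ 2 - 2 * (⟪v - w, (ω : V3)⟫_ℝ * ⟪v, (ω : V3)⟫_ℝ) + ⟪v - w, (ω : V3)⟫_ℝ ^ 2 := by
    rw [norm_sub_sq_real, inner_smul_right, norm_smul, Real.norm_eq_abs, hω, mul_one, sq_abs]
  have h4 : ‖w + ⟪v - w, (ω : V3)⟫_ℝ • (ω : V3)‖ ^ 2 =
      ‖w‖ ^ 2 + 2 * (⟪v - w, (ω : V3)⟫_ℝ * ⟪w, (ω : V3)⟫_ℝ) + ⟪v - w, (ω : V3)⟫_ℝ ^ 2 := by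
    rw [norm_add_sq_real, inner_smul_right, norm_smul, Real.norm_eq_abs, hω, mul_one, sq_abs]
  have hq : ⟪v - w, (ω : V3)⟫_ℝ = ⟪v, (ω : V3)⟫_ℝ - ⟪w, (ω : V3)⟫_ℝ := inner_sub_left _ _ _
  rw [h1, h2, h3, h4, inner_sub_left cx.2.1 cy.2.1, inner_add_left v w, hq]
  ring

/-- **Quadratic growth of the hydrodynamic test function**: `|α + β·v + γ|v|²/2| ≤ 3C (1 + |v|²)` if
`‖(α, β, γ)‖ ≤ C`. [folklore] -/
theorem k2r_tr_abs_affine_le {c : ℝ × V3 × ℝ} {C : ℝ} (hc : ‖c‖ ≤ C) (v : V3) :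
    |c.1 + ⟪c.2.1, v⟫_ℝ + c.2.2 * ‖v‖ ^ 2 / 2| ≤ 3 * C * (1 + ‖v‖ ^ 2) := by
  have hC : 0 ≤ C := (norm_nonneg _).trans hc
  have h := abs_testFn_le (κv := 0) (lamInv := 0) v hc (by rw [abs_zero]; positivity)
  simpa using h

/-! ## The slice: fixed position pair and impact direction -/

/-- Growth of the two pair kernels against `((1 + |v|)(1 + |w|))³`: `|q₊ q| ≤ X³` and
`|q₊ q ((v+w)·ω/2)| ≤ X³`, `X = (1 + |v|)(1 + |w|)`, `q = (v − w)·ω`, `|ω| = 1`. [folklore] -/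
theorem k2r_tr_pair_kernels_le (ω : sphere (0 : V3) 1) (v w : V3) :
    |max ⟪v - w, (ω : V3)⟫_ℝ 0 * ⟪v - w, (ω : V3)⟫_ℝ| ≤ 1 * ((1 + ‖v‖) * (1 + ‖w‖)) ^ 3 ∧
      |max ⟪v - w, (ω : V3)⟫_ℝ 0 * ⟪v - w, (ω : V3)⟫_ℝ * (⟪v + w, (ω : V3)⟫_ℝ / 2)| ≤
        1 * ((1 + ‖v‖) * (1 + ‖w‖)) ^ 3 := by
  have hω : ‖(ω : V3)‖ = 1 := norm_eq_of_mem_sphere ω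
  set X : ℝ := (1 + ‖v‖) * (1 + ‖w‖) with hX
  have hX1 : 1 ≤ X := by
    rw [hX]; nlinarith [norm_nonneg v, norm_nonneg w, mul_nonneg (norm_nonneg v) (norm_nonneg w)]
  have hsub : |⟪v - w, (ω : V3)⟫_ℝ| ≤ X := k2r_abs_inner_sub_le v w _ hω
  have hadd : |⟪v + w, (ω : V3)⟫_ℝ| ≤ X := k2r_abs_inner_add_le v w _ hω
  have hk : |max ⟪v - w, (ω : V3)⟫_ℝ 0 * ⟪v - w, (ω : V3)⟫_ℝ| ≤ X ^ 2 := by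
    refine (k2r_abs_posMul_le _).trans ?_
    rw [← sq_abs]
    exact pow_le_pow_left₀ (abs_nonneg _) hsub 2
  have hX0 : 0 ≤ X := zero_le_one.trans hX1
  refine ⟨?_, ?_⟩
  · rw [one_mul]
    exact hk.trans (pow_le_pow_right₀ hX1 (by norm_num))
  · rw [one_mul, abs_mul, abs_div, abs_two]
    have h2 : |⟪v + w, (ω : V3)⟫_ℝ| / 2 ≤ X := by linarith [abs_nonneg ⟪v + w, (ω : V3)⟫_ℝ]
    calc |max ⟪v - w, (ω : V3)⟫_ℝ 0 * ⟪v - w, (ω : V3)⟫_ℝ| * (|⟪v + w, (ω : V3)⟫_ℝ| / 2)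
        ≤ X ^ 2 * X := mul_le_mul hk h2 (by positivity) (by positivity)
      _ = X ^ 3 := by ring

/-- **The transfer slice.** For a fixed position pair (coefficient triples `c = (α, β, γ)`, `c′`, local
Maxwellians `M = M_{1,θ,u}`, `M′ = M_{1,θ′,u′}`, densities `r, r′`, contact factor `a`) and a fixed impact
direction `ω`:
`∫ r M(v) ∫ ((v−w)·ω)₊ a (r′ M′(w)) [ψ_c(v′) + ψ_{c′}(w′) − ψ_c(v) − ψ_{c′}(w)] dw dv
  = −(a r r′) [ (β − β′)·ω · J₁ + (γ − γ′) · J₂ ]`,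
`J₁ = ∫∫ q₊ q M(v) M′(w)`, `J₂ = ∫∫ q₊ q ((v+w)·ω/2) M(v) M′(w)`, `q = (v−w)·ω` (`k2r_tr_affine_increment` and
linearity of the absolutely convergent pair integrals). [cite: ChapmanCowling1970, §16] -/
theorem k2r_tr_slice {θ θ' : ℝ} (hθ : 0 < θ) (hθ' : 0 < θ') (u u' : V3) (ω : sphere (0 : V3) 1)
    (cx cy : ℝ × V3 × ℝ) (a r r' : ℝ) :
    ∫ v, r * localMaxwellian 1 θ u v * ∫ w, max ⟪v - w, (ω : V3)⟫_ℝ 0 * a *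
        (r' * localMaxwellian 1 θ' u' w) *
        ((cx.1 + ⟪cx.2.1, v - ⟪v - w, (ω : V3)⟫_ℝ • (ω : V3)⟫_ℝ +
            cx.2.2 * ‖v - ⟪v - w, (ω : V3)⟫_ℝ • (ω : V3)‖ ^ 2 / 2) +
          (cy.1 + ⟪cy.2.1, w + ⟪v - w, (ω : V3)⟫_ℝ • (ω : V3)⟫_ℝ +
            cy.2.2 * ‖w + ⟪v - w, (ω : V3)⟫_ℝ • (ω : V3)‖ ^ 2 / 2) -
          (cx.1 + ⟪cx.2.1, v⟫_ℝ + cx.2.2 * ‖v‖ ^ 2 / 2) -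
          (cy.1 + ⟪cy.2.1, w⟫_ℝ + cy.2.2 * ‖w‖ ^ 2 / 2)) =
      -(a * r * r') * (⟪cx.2.1 - cy.2.1, (ω : V3)⟫_ℝ *
          (∫ v, ∫ w, max ⟪v - w, (ω : V3)⟫_ℝ 0 * ⟪v - w, (ω : V3)⟫_ℝ *
            (localMaxwellian 1 θ u v * localMaxwellian 1 θ' u' w)) +
        (cx.2.2 - cy.2.2) *
          ∫ v, ∫ w, max ⟪v - w, (ω : V3)⟫_ℝ 0 * ⟪v - w, (ω : V3)⟫_ℝ * (⟪v + w, (ω : V3)⟫_ℝ / 2) *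
            (localMaxwellian 1 θ u v * localMaxwellian 1 θ' u' w)) := by
  set M : V3 → ℝ := localMaxwellian 1 θ u with hM
  set M' : V3 → ℝ := localMaxwellian 1 θ' u' with hM'
  set A : ℝ := ⟪cx.2.1 - cy.2.1, (ω : V3)⟫_ℝ with hA
  set B : ℝ := cx.2.2 - cy.2.2 with hB
  set K : ℝ := a * r * r' with hK
  -- the two pair integrands and the full integrand
  set F₁ : V3 × V3 → ℝ := fun p =>
    max ⟪p.1 - p.2, (ω : V3)⟫_ℝ 0 * ⟪p.1 - p.2, (ω : V3)⟫_ℝ * (M p.1 * M' p.2) with hF₁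
  set F₂ : V3 × V3 → ℝ := fun p =>
    max ⟪p.1 - p.2, (ω : V3)⟫_ℝ 0 * ⟪p.1 - p.2, (ω : V3)⟫_ℝ * (⟪p.1 + p.2, (ω : V3)⟫_ℝ / 2) *
      (M p.1 * M' p.2) with hF₂
  set F : V3 × V3 → ℝ := fun p => -K * (A * F₁ p + B * F₂ p) with hF
  have hq : Continuous fun p : V3 × V3 => ⟪p.1 - p.2, (ω : V3)⟫_ℝ :=
    (continuous_fst.sub continuous_snd).inner continuous_const
  have hF₁i : Integrable F₁ ((volume : Measure V3).prod volume) :=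
    k2r_integrable_weight_mul_localMaxwellian_prod hθ hθ' u u'
      (k2r_continuous_posMul_kernel (ω : V3)).aestronglyMeasurable (C := 1) (m := 3)
      (fun p => (k2r_tr_pair_kernels_le ω p.1 p.2).1)
  have hF₂i : Integrable F₂ ((volume : Measure V3).prod volume) := by
    refine k2r_integrable_weight_mul_localMaxwellian_prod hθ hθ' u u' ?_ (C := 1) (m := 3)
      (fun p => (k2r_tr_pair_kernels_le ω p.1 p.2).2)
    refine Continuous.aestronglyMeasurable ?_
    exact (k2r_continuous_posMul_kernel (ω : V3)).mul
      (((continuous_fst.add continuous_snd).inner continuous_const).div_const _)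
  have hFi : Integrable F ((volume : Measure V3).prod volume) :=
    ((hF₁i.const_mul A).add (hF₂i.const_mul B)).const_mul _
  -- the registered iterated integrals are product integrals
  have hJ₁ : (∫ v, ∫ w, max ⟪v - w, (ω : V3)⟫_ℝ 0 * ⟪v - w, (ω : V3)⟫_ℝ * (M v * M' w)) =
      ∫ p, F₁ p ∂((volume : Measure V3).prod volume) := (integral_prod F₁ hF₁i).symm
  have hJ₂ : (∫ v, ∫ w, max ⟪v - w, (ω : V3)⟫_ℝ 0 * ⟪v - w, (ω : V3)⟫_ℝ * (⟪v + w, (ω : V3)⟫_ℝ / 2) *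
      (M v * M' w)) = ∫ p, F₂ p ∂((volume : Measure V3).prod volume) := (integral_prod F₂ hF₂i).symm
  -- the rows of the slice are the rows of `F`
  have hrow : ∀ v : V3, r * M v * ∫ w, max ⟪v - w, (ω : V3)⟫_ℝ 0 * a * (r' * M' w) *
      ((cx.1 + ⟪cx.2.1, v - ⟪v - w, (ω : V3)⟫_ℝ • (ω : V3)⟫_ℝ +
          cx.2.2 * ‖v - ⟪v - w, (ω : V3)⟫_ℝ • (ω : V3)‖ ^ 2 / 2) +
        (cy.1 + ⟪cy.2.1, w + ⟪v - w, (ω : V3)⟫_ℝ • (ω : V3)⟫_ℝ +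
          cy.2.2 * ‖w + ⟪v - w, (ω : V3)⟫_ℝ • (ω : V3)‖ ^ 2 / 2) -
        (cx.1 + ⟪cx.2.1, v⟫_ℝ + cx.2.2 * ‖v‖ ^ 2 / 2) -
        (cy.1 + ⟪cy.2.1, w⟫_ℝ + cy.2.2 * ‖w‖ ^ 2 / 2)) = ∫ w, F (v, w) := by
    intro v
    rw [← integral_const_mul]
    refine integral_congr_ae (Eventually.of_forall fun w => ?_)
    simp only [hF, hF₁, hF₂, hK, hA, hB]
    rw [k2r_tr_affine_increment ω cx cy v w]
    ring
  rw [integral_congr_ae (Eventually.of_forall hrow), ← integral_prod F hFi, hJ₁, hJ₂]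
  simp only [hF]
  rw [integral_const_mul, integral_add (hF₁i.const_mul A) (hF₂i.const_mul B), integral_const_mul,
    integral_const_mul]

/-! ## The reduction for a general background -/

/-- **Reduction of the hydrodynamic collisional transfer to position × direction.** For continuous profiles
`ρ₀, θ₀, u₀` on `𝕋³` (`|ρ₀| ≤ R`, `0 < θ₀ ≤ Θ`, `‖u₀‖ ≤ U`), a continuous contact factor `|Y(x,ω)| ≤ Ȳ`, a
continuous coefficient field `c = (α, β, γ)` with `‖c‖ ≤ C`, and constants `ε, λ`: with
`ψ_x(v) = α(x) + β(x)·v + γ(x)|v|²/2`, `y = x + εω`, `M_x = M_{1,θ₀(x),u₀(x)}`,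
`∫_{𝕋³}∫ ρ₀M_x(v) · λ∫_{S²}∫ ((v−w)·ω)₊ Y ρ₀(y)M_y(w) [ψ_x(v′) + ψ_y(w′) − ψ_x(v) − ψ_y(w)] dw dσ dv dx`
`= λ ∫_{S²}∫_{𝕋³} −Y ρ₀(x)ρ₀(y) [(β(x) − β(y))·ω J₁(x,ω) + (γ(x) − γ(y)) J₂(x,ω)] dx dσ`
(Fubini `k2r_tr_pairing_swap`, then `k2r_tr_slice` pointwise in `(ω, x)`).
[cite: ChapmanCowling1970, §16] -/
theorem k2r_tr_reduction {ρ₀ θ₀ : T3 → ℝ} {u₀ : T3 → V3} (hρc : Continuous ρ₀) (hθc : Continuous θ₀)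
    (huc : Continuous u₀) {R Θ U : ℝ} (hρb : ∀ x, |ρ₀ x| ≤ R) (hθpos : ∀ x, 0 < θ₀ x)
    (hθΘ : ∀ x, θ₀ x ≤ Θ) (hub : ∀ x, ‖u₀ x‖ ≤ U) {Yf : T3 → sphere (0 : V3) 1 → ℝ}
    (hYc : Continuous (uncurry Yf)) {Yb : ℝ} (hYb : ∀ x ω, |Yf x ω| ≤ Yb) {cc : T3 → ℝ × V3 × ℝ}
    (hcc : Continuous cc) {C : ℝ} (hcb : ∀ x, ‖cc x‖ ≤ C) (ε lam : ℝ) :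
    ∫ x, ∫ v, ρ₀ x * localMaxwellian 1 (θ₀ x) (u₀ x) v *
        (lam * ∫ ω : sphere (0 : V3) 1, (∫ w, max ⟪v - w, (ω : V3)⟫_ℝ 0 * Yf x ω *
          (ρ₀ ((Torus.geometry (Fin 3)).translate x (ε • (ω : V3))) *
            localMaxwellian 1 (θ₀ ((Torus.geometry (Fin 3)).translate x (ε • (ω : V3))))
              (u₀ ((Torus.geometry (Fin 3)).translate x (ε • (ω : V3)))) w) *
          (((cc x).1 + ⟪(cc x).2.1, v - ⟪v - w, (ω : V3)⟫_ℝ • (ω : V3)⟫_ℝ +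
              (cc x).2.2 * ‖v - ⟪v - w, (ω : V3)⟫_ℝ • (ω : V3)‖ ^ 2 / 2) +
            ((cc ((Torus.geometry (Fin 3)).translate x (ε • (ω : V3)))).1 +
              ⟪(cc ((Torus.geometry (Fin 3)).translate x (ε • (ω : V3)))).2.1,
                w + ⟪v - w, (ω : V3)⟫_ℝ • (ω : V3)⟫_ℝ +
              (cc ((Torus.geometry (Fin 3)).translate x (ε • (ω : V3)))).2.2 *
                ‖w + ⟪v - w, (ω : V3)⟫_ℝ • (ω : V3)‖ ^ 2 / 2) -
            ((cc x).1 + ⟪(cc x).2.1, v⟫_ℝ + (cc x).2.2 * ‖v‖ ^ 2 / 2) -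
            ((cc ((Torus.geometry (Fin 3)).translate x (ε • (ω : V3)))).1 +
              ⟪(cc ((Torus.geometry (Fin 3)).translate x (ε • (ω : V3)))).2.1, w⟫_ℝ +
              (cc ((Torus.geometry (Fin 3)).translate x (ε • (ω : V3)))).2.2 * ‖w‖ ^ 2 / 2))) ∂sphereMeasure) =
      lam * ∫ ω : sphere (0 : V3) 1, (∫ x,
        -(Yf x ω * ρ₀ x * ρ₀ ((Torus.geometry (Fin 3)).translate x (ε • (ω : V3)))) *
          (⟪(cc x).2.1 - (cc ((Torus.geometry (Fin 3)).translate x (ε • (ω : V3)))).2.1, (ω : V3)⟫_ℝ *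
              (∫ v, ∫ w, max ⟪v - w, (ω : V3)⟫_ℝ 0 * ⟪v - w, (ω : V3)⟫_ℝ *
                (localMaxwellian 1 (θ₀ x) (u₀ x) v *
                  localMaxwellian 1 (θ₀ ((Torus.geometry (Fin 3)).translate x (ε • (ω : V3))))
                    (u₀ ((Torus.geometry (Fin 3)).translate x (ε • (ω : V3)))) w)) +
            ((cc x).2.2 - (cc ((Torus.geometry (Fin 3)).translate x (ε • (ω : V3)))).2.2) *
              ∫ v, ∫ w, max ⟪v - w, (ω : V3)⟫_ℝ 0 * ⟪v - w, (ω : V3)⟫_ℝ * (⟪v + w, (ω : V3)⟫_ℝ / 2) *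
                (localMaxwellian 1 (θ₀ x) (u₀ x) v *
                  localMaxwellian 1 (θ₀ ((Torus.geometry (Fin 3)).translate x (ε • (ω : V3))))
                    (u₀ ((Torus.geometry (Fin 3)).translate x (ε • (ω : V3)))) w))) ∂sphereMeasure := by
  -- the hydrodynamic test function: continuity and quadratic growth
  set κ : T3 → V3 → ℝ := fun x v => (cc x).1 + ⟪(cc x).2.1, v⟫_ℝ + (cc x).2.2 * ‖v‖ ^ 2 / 2 with hκ
  have hκc : Continuous (uncurry κ) := by
    have h1 : Continuous fun p : T3 × V3 => cc p.1 := hcc.comp continuous_fst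
    have h2 : Continuous fun p : T3 × V3 =>
        (cc p.1).1 + ⟪(cc p.1).2.1, p.2⟫_ℝ + (cc p.1).2.2 * ‖p.2‖ ^ 2 / 2 := by fun_prop
    exact h2
  have hκb : ∀ x v, |κ x v| ≤ 3 * C * (1 + ‖v‖ ^ 2) := fun x v => k2r_tr_abs_affine_le (hcb x) v
  have hsw := k2r_tr_pairing_swap hρc hθc huc hρb hθpos hθΘ hub hYc hYb hκc hκb ε lam
  refine hsw.trans ?_
  congr 1
  refine integral_congr_ae (Eventually.of_forall fun ω => ?_)
  refine integral_congr_ae (Eventually.of_forall fun x => ?_)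
  exact k2r_tr_slice (hθpos x) (hθpos _) (u₀ x) (u₀ _) ω (cc x) (cc _) (Yf x ω) (ρ₀ x) (ρ₀ _)

/-! ## The registered statement -/

/-- **G3a — reduction of the hydrodynamic transfer to position × direction (stub `stub_transferReduction` of the
K2R line `birth`).** Along a packing-guarded classical hs-Euler solution and for an admissible family `(c, κ)`,
for every `N` and `s ∈ [0, t]`: `B_ψ(N, s) = λ_N · T(N, s)` in the crux's own `let`-vocabulary
(`B_ψ = ∫∫ f L^N[ψ]`, `T = ∫_{S²}∫_{𝕋³} −Y ρ(x)ρ(y) [(β(x)−β(y))·ω J₁ + (γ(x)−γ(y)) J₂] dx dσ`, `y = x + ε_Nω`).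
The collision increment of `ψ = α + β·v + γ|v|²/2` is `−q[(β(x)−β(y))·ω + (γ(x)−γ(y))(v+w)·ω/2]`; Fubini
`(x, v, ω, w) → (ω, x, v, w)` under Gaussian domination; the bracket is linear (`k2r_tr_reduction` at the
frozen time `s`, with the window facts `eulerProfiles_window`, `contactValue_window`).
[cite: ChapmanCowling1970, §16] -/
theorem stub_transferReduction :
  ∀ (η₁ : ℝ), 0 < η₁ → AnalyticOnNhd ℝ Literature.MathematicalPhysics.KineticTheory.hsExcessFreeEnergy (Set.Ioo 0 η₁) →
  ∀ (σ T : ℝ), 0 < σ → σ ≤ 1 → ∀ (ρ θ : ℝ → UnitAddTorus (Fin 3) → ℝ) (u : ℝ → UnitAddTorus (Fin 3) → EuclideanSpace ℝ (Fin 3)),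
  Literature.MathematicalPhysics.KineticTheory.IsHardSphereEulerSolution σ T ρ u θ →
  ∀ t ∈ Set.Ioo 0 T, (∀ s ∈ Set.Icc 0 t, ∀ x, ρ s x * σ ^ 3 < η₁) →
  ∀ (c : ℕ → ℝ → UnitAddTorus (Fin 3) → ℝ × EuclideanSpace ℝ (Fin 3) × ℝ) (κ : ℕ → ℝ → UnitAddTorus (Fin 3) → EuclideanSpace ℝ (Fin 3) → ℝ),
  (∀ N, Continuous (Function.uncurry (c N))) →
  (∀ N, Continuous (fun p : ℝ × UnitAddTorus (Fin 3) × EuclideanSpace ℝ (Fin 3) => κ N p.1 p.2.1 p.2.2)) →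
  ∀ (C : ℝ), (∀ N s x x' v v', ‖c N s x‖ ≤ C ∧ dist (c N s x) (c N s x') ≤ C * dist x x' ∧ |κ N s x v| ≤ C * (1 + ‖v‖ ^ 2) ∧
    |κ N s x v - κ N s x' v'| ≤ C * (1 + ‖v‖ ^ 2 + ‖v'‖ ^ 2) * (dist x x' + ‖v - v'‖)) →
  (let G := Literature.Analysis.FluidPDE.Torus.geometry (Fin 3)
   let ε := fun N : ℕ => Literature.MathematicalPhysics.KineticTheory.hsDiameter σ N
   let lam := fun N : ℕ => (N : ℝ) * ε N ^ 2
   let f := fun (s : ℝ) (x : UnitAddTorus (Fin 3)) (v : EuclideanSpace ℝ (Fin 3)) => ρ s x * Literature.Analysis.FluidPDE.localMaxwellian 1 (θ s x) (u s x) v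
   let Y := fun η : ℝ => 3 / (2 * Real.pi) * deriv Literature.MathematicalPhysics.KineticTheory.hsExcessFreeEnergy η
   let ψ := fun (N : ℕ) (s : ℝ) (x : UnitAddTorus (Fin 3)) (v : EuclideanSpace ℝ (Fin 3)) => (c N s x).1 + inner ℝ (c N s x).2.1 v + (c N s x).2.2 * ‖v‖ ^ 2 / 2
   let Lψ := fun (N : ℕ) (s : ℝ) (x : UnitAddTorus (Fin 3)) (v : EuclideanSpace ℝ (Fin 3)) => lam N * ∫ ω : Metric.sphere (0 : EuclideanSpace ℝ (Fin 3)) 1, (let y := G.translate x (ε N • (ω : EuclideanSpace ℝ (Fin 3))); ∫ w : EuclideanSpace ℝ (Fin 3), max (inner ℝ (v - w) ω) 0 * Y (σ ^ 3 * ρ s (G.translate x ((ε N / 2) • (ω : EuclideanSpace ℝ (Fin 3))))) * f s y w * (ψ N s x (v - inner ℝ (v - w) ω • (ω : EuclideanSpace ℝ (Fin 3))) + ψ N s y (w + inner ℝ (v - w) ω • (ω : EuclideanSpace ℝ (Fin 3))) - ψ N s x v - ψ N s y w)) ∂Literature.MathematicalPhysics.KineticTheory.sphereMeasure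
   let Bψ := fun (N : ℕ) (s : ℝ) => ∫ x : UnitAddTorus (Fin 3), ∫ v : EuclideanSpace ℝ (Fin 3), f s x v * Lψ N s x v
   let J₁ := fun (N : ℕ) (s : ℝ) (x : UnitAddTorus (Fin 3)) (ω : Metric.sphere (0 : EuclideanSpace ℝ (Fin 3)) 1) => ∫ v : EuclideanSpace ℝ (Fin 3), ∫ w : EuclideanSpace ℝ (Fin 3), max (inner ℝ (v - w) ω) 0 * inner ℝ (v - w) ω * (Literature.Analysis.FluidPDE.localMaxwellian 1 (θ s x) (u s x) v * Literature.Analysis.FluidPDE.localMaxwellian 1 (θ s (G.translate x (ε N • (ω : EuclideanSpace ℝ (Fin 3))))) (u s (G.translate x (ε N • (ω : EuclideanSpace ℝ (Fin 3))))) w)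
   let J₂ := fun (N : ℕ) (s : ℝ) (x : UnitAddTorus (Fin 3)) (ω : Metric.sphere (0 : EuclideanSpace ℝ (Fin 3)) 1) => ∫ v : EuclideanSpace ℝ (Fin 3), ∫ w : EuclideanSpace ℝ (Fin 3), max (inner ℝ (v - w) ω) 0 * inner ℝ (v - w) ω * (inner ℝ (v + w) ω / 2) * (Literature.Analysis.FluidPDE.localMaxwellian 1 (θ s x) (u s x) v * Literature.Analysis.FluidPDE.localMaxwellian 1 (θ s (G.translate x (ε N • (ω : EuclideanSpace ℝ (Fin 3))))) (u s (G.translate x (ε N • (ω : EuclideanSpace ℝ (Fin 3))))) w)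
   let T := fun (N : ℕ) (s : ℝ) => ∫ ω : Metric.sphere (0 : EuclideanSpace ℝ (Fin 3)) 1, (∫ x : UnitAddTorus (Fin 3), -(Y (σ ^ 3 * ρ s (G.translate x ((ε N / 2) • (ω : EuclideanSpace ℝ (Fin 3))))) * ρ s x * ρ s (G.translate x (ε N • (ω : EuclideanSpace ℝ (Fin 3))))) * (inner ℝ ((c N s x).2.1 - (c N s (G.translate x (ε N • (ω : EuclideanSpace ℝ (Fin 3))))).2.1) ω * J₁ N s x ω + ((c N s x).2.2 - (c N s (G.translate x (ε N • (ω : EuclideanSpace ℝ (Fin 3))))).2.2) * J₂ N s x ω)) ∂Literature.MathematicalPhysics.KineticTheory.sphereMeasure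
   ∀ (N : ℕ), ∀ s ∈ Set.Icc 0 t, Bψ N s = lam N * T N s) := by
  intro η₁ _hη₁ han σ T hσ _hσ1 ρ θ u hEul t ht hguard c κ hc _hκ C hadm G ε lam f Y ψ Lψ Bψ J₁ J₂ Tf N s
    hs
  -- window facts of the hs-Euler solution on `[0, t] × 𝕋³`
  obtain ⟨hρc, huc, hθc, R, U, Θ, hρR, huU, hθΘ⟩ := eulerProfiles_window hEul ht.2
  have hρpos : ∀ s ∈ Icc 0 t, ∀ x, 0 < ρ s x := fun s hs x => (hρR s hs x).1
  obtain ⟨hYc, Ybar, hYbar⟩ := contactValue_window hσ han hρc hρpos hguard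
  -- the frozen-time profiles
  have hsx : ∀ x : T3, ((s, x) : ℝ × T3) ∈ Icc 0 t ×ˢ (univ : Set T3) := fun x => ⟨hs, mem_univ x⟩
  have hρs : Continuous (ρ s) := hρc.comp_continuous (Continuous.prodMk_right s) hsx
  have hθs : Continuous (θ s) := hθc.comp_continuous (Continuous.prodMk_right s) hsx
  have hus : Continuous (u s) := huc.comp_continuous (Continuous.prodMk_right s) hsx
  have hYs : Continuous fun z : T3 => Y (σ ^ 3 * ρ s z) :=
    hYc.comp_continuous (Continuous.prodMk_right s) hsx
  have hYf : Continuous (uncurry fun (x : T3) (ω : sphere (0 : V3) 1) =>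
      Y (σ ^ 3 * ρ s (G.translate x ((ε N / 2) • (ω : V3))))) :=
    hYs.comp (continuous_torus_translate_sphere (ε N / 2))
  have hYb : ∀ (x : T3) (ω : sphere (0 : V3) 1),
      |Y (σ ^ 3 * ρ s (G.translate x ((ε N / 2) • (ω : V3))))| ≤ Ybar := fun x ω => hYbar s hs _
  have hcs : Continuous (c N s) := (hc N).comp (Continuous.prodMk_right s)
  have hcb : ∀ x, ‖c N s x‖ ≤ C := fun x => (hadm N s x x 0 0).1
  have hρb : ∀ x, |ρ s x| ≤ R := fun x => by
    rw [abs_of_pos (hρR s hs x).1]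
    exact (hρR s hs x).2
  have key := k2r_tr_reduction hρs hθs hus hρb (fun x => (hθΘ s hs x).1) (fun x => (hθΘ s hs x).2)
    (fun x => huU s hs x) hYf hYb hcs hcb (ε N) (lam N)
  exact key

end Summit.AtomisticToContinuum.HydrodynamicLimit.Theorems.EnskogAdjointDuality

end
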